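import Summits.AtomisticToContinuum.Crystallization.Theses.PeriodCoherenceLadder

/-!
# Route `PeriodCoherenceLadder`, item `GlobalFromScaleUniform`: the node's dictionary is a theorem

**Coarse periods on balls of every radius, with uniform constants, give a GLOBAL coarse period of a limit hull point**
(`globalFromScaleUniform_proof`, closing the route decl `PeriodCoherenceLadder.GlobalFromScaleUniform`; decomp-a2c
lens-3 gen 3, the certified EQUIV of the node, direction scale-uniform ⇒ global; the converse is `X_L := X`).

Proof.  Bolzano–Weierstrass for the translations `t_L` (`δ ≤ ‖t_L‖ ≤ b`); local-matching compactness of the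
`δ`-separated hull points `X_L` (block A of `Theorems.PeriodPrecisionLadderExactPeriodFromFine`, available through the route file's imports); the radius
of validity escapes to infinity along the subsequence; for `y` in the limit set `Y` and every `η > 0` some point of `Y`
lies within `δ/4 + η` of `y ± t∞`, and uniform discreteness makes the infimum ATTAINED (finitely many candidates in a
ball); the hull is closed under local limits.  [BaakeGrimm2013 Remark 5.6, Prop. 5.3; KellendonkLenz2013 Thm 7.1]
-/

noncomputable section

namespace Summit.AtomisticToContinuum.Crystallization.Theorems

namespace PeriodCoherenceLadderGlobalFromScaleUniform

open Literature.MathematicalPhysics.StatisticalMechanics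
open Filter Topology Metric
open Summit.AtomisticToContinuum.Crystallization.Theorems.PeriodPrecisionLadderExactPeriodFromFine

/-- **`GlobalFromScaleUniform` holds** (the certified EQUIV of the node, direction scale-uniform ⇒ global).  Given,
with uniform constants, for every radius `n` a `δ`-separated `r`-dense hull point `X_n` and a translation `t_n`
(`δ ≤ ‖t_n‖ ≤ b`) moving every point of `X_n` in the ball `‖p‖ ≤ n` into `X_n` up to `δ/4` (two-sidedly):
Bolzano–Weierstrass gives `t_n → t∞`, `‖t∞‖ ≥ δ`, along `φ₁`; block A gives a `δ`-separated local limit `Y` of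
`X ∘ φ₁ ∘ φ₂`; `Y` is `(r+1)`-dense and a hull point (hull closed under local limits); for `y ∈ Y` and every
`η > 0` some point of `Y` lies within `δ/4 + η` of `y ± t∞` (match `y` to `p ∈ X_k` with `k` so large that
`‖p‖ ≤ k`, move by `t_k`, match back), and since `Y` is uniformly discrete the infimum over `η` is attained:
some point of `Y` lies within `δ/4` of `y ± t∞`.  [BaakeGrimm2013 Remark 5.6, Prop. 5.3; folklore] -/
theorem globalFromScaleUniform_proof :
    Summit.AtomisticToContinuum.Crystallization.Theses.PeriodCoherenceLadder.GlobalFromScaleUniform := by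
  rintro x ⟨δ, r, b, hδ, H⟩
  -- data at radius n
  have H' : ∀ n : ℕ, ∃ (X : Set (EuclideanSpace ℝ (Fin 3))) (t : EuclideanSpace ℝ (Fin 3)),
      (∀ p ∈ X, ∀ q ∈ X, p ≠ q → δ ≤ dist p q) ∧
      (∀ c : EuclideanSpace ℝ (Fin 3), ∃ p ∈ X, dist p c ≤ r) ∧
      (∀ R ε' : ℝ, 0 < ε' → ∃ᶠ N in Filter.atTop, ∃ s : EuclideanSpace ℝ (Fin 3),
        (∀ p ∈ X, ‖p‖ ≤ R → ∃ i : Fin N, dist (x N i + s) p ≤ ε') ∧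
        (∀ i : Fin N, ‖x N i + s‖ ≤ R → ∃ p ∈ X, dist (x N i + s) p ≤ ε')) ∧
      δ ≤ ‖t‖ ∧ ‖t‖ ≤ b ∧
      ∀ p ∈ X, ‖p‖ ≤ (n : ℝ) → (∃ q ∈ X, dist (p + t) q ≤ δ / 4) ∧ (∃ q ∈ X, dist (p - t) q ≤ δ / 4) := by
    intro n
    obtain ⟨X, hs, hd, hh, t, hta, htb, hap⟩ := H (n : ℝ)
    exact ⟨X, t, hs, hd, hh, hta, htb, hap⟩
  choose X t hsep hden hhull hta htb hAP using H'
  have hb : 0 ≤ b := le_trans (norm_nonneg _) (htb 0)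
  -- Bolzano–Weierstrass for the translations
  obtain ⟨tinf, -, φ₁, hφ₁, hlim⟩ := tendsto_subseq_of_bounded
    (Metric.isBounded_closedBall : Bornology.IsBounded (closedBall (0 : EuclideanSpace ℝ (Fin 3)) b))
    (fun n => mem_closedBall_zero_iff.2 (htb n))
  have hta_inf : δ ≤ ‖tinf‖ :=
    ge_of_tendsto hlim.norm (Eventually.of_forall fun n => hta (φ₁ n))
  -- local-matching compactness for the sets along φ₁
  obtain ⟨φ₂, Y, hφ₂, hYsep, hmatch⟩ :=
    exists_subseq_forall_eventually_match hδ (fun n => X (φ₁ n)) (fun n => hsep (φ₁ n))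
  have hlimψ : Tendsto (fun k => t (φ₁ (φ₂ k))) atTop (𝓝 tinf) := hlim.comp hφ₂.tendsto_atTop
  have hψmono : StrictMono (fun k => φ₁ (φ₂ k)) := hφ₁.comp hφ₂
  -- the radius along the subsequence exceeds any bound eventually
  have hrad : ∀ M : ℝ, ∀ᶠ k in atTop, M ≤ ((φ₁ (φ₂ k) : ℕ) : ℝ) := by
    intro M
    obtain ⟨m, hm⟩ := exists_nat_ge M
    filter_upwards [eventually_ge_atTop m] with k hk
    have h1 : (m : ℝ) ≤ ((φ₁ (φ₂ k) : ℕ) : ℝ) := by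
      exact_mod_cast hk.trans (hψmono.le_apply)
    exact hm.trans h1
  -- (i) Y is (r+1)-dense
  have hYden : ∀ c : EuclideanSpace ℝ (Fin 3), ∃ p ∈ Y, dist p c ≤ r + 1 := by
    intro c
    obtain ⟨k, hk⟩ := (hmatch (‖c‖ + r) 1 one_pos).exists
    obtain ⟨p, hp, hpc⟩ := hden (φ₁ (φ₂ k)) c
    have hpn : ‖p‖ ≤ ‖c‖ + r := by
      have h1 : ‖p‖ ≤ ‖c‖ + dist p c := by
        have := norm_le_norm_add_norm_sub' p c
        rwa [← dist_eq_norm] at this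
      linarith
    obtain ⟨s, hs, hps⟩ := hk.2 p hp hpn
    refine ⟨s, hs, ?_⟩
    calc dist s c ≤ dist p s + dist p c := dist_triangle_left _ _ _
      _ ≤ 1 + r := add_le_add hps hpc
      _ = r + 1 := add_comm _ _
  -- (ii) uniform discreteness: an infimum of distances to Y that is ≤ δ/4 + η for every η > 0 is attained ≤ δ/4
  have hattain : ∀ z : EuclideanSpace ℝ (Fin 3),
      (∀ η : ℝ, 0 < η → ∃ y' ∈ Y, dist z y' ≤ δ / 4 + η) → ∃ y' ∈ Y, dist z y' ≤ δ / 4 := by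
    intro z hz
    by_contra hcon
    push Not at hcon
    have hfin : (Y ∩ closedBall z (δ / 4 + 1)).Finite :=
      finite_of_forall_le_dist_of_subset_closedBall hδ
        (fun p hp q hq hpq => hYsep p hp.1 q hq.1 hpq) Set.inter_subset_right
    obtain ⟨y₁, hy₁, hd₁⟩ := hz 1 one_pos
    have hne : hfin.toFinset.Nonempty := by
      refine ⟨y₁, ?_⟩
      rw [Set.Finite.mem_toFinset]
      exact ⟨hy₁, by rw [mem_closedBall, dist_comm]; exact hd₁⟩
    obtain ⟨y₀, hy₀F, hmin⟩ := hfin.toFinset.exists_min_image (fun y => dist z y) hne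
    rw [Set.Finite.mem_toFinset] at hy₀F
    have hgap : δ / 4 < dist z y₀ := hcon y₀ hy₀F.1
    obtain ⟨y₂, hy₂, hd₂⟩ := hz (min ((dist z y₀ - δ / 4) / 2) 1) (lt_min (by linarith) one_pos)
    have hy₂F : y₂ ∈ hfin.toFinset := by
      rw [Set.Finite.mem_toFinset]
      refine ⟨hy₂, ?_⟩
      rw [mem_closedBall, dist_comm]
      exact hd₂.trans (by linarith [min_le_right ((dist z y₀ - δ / 4) / 2) (1 : ℝ)])
    have h1 := hmin y₂ hy₂F
    have h2 := min_le_left ((dist z y₀ - δ / 4) / 2) (1 : ℝ)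
    have h3 : dist z y₀ ≤ δ / 4 + (dist z y₀ - δ / 4) / 2 := h1.trans (hd₂.trans (by linarith))
    linarith
  -- (iii) Y has the GLOBAL coarse period tinf
  have hper : ∀ y ∈ Y, (∃ y' ∈ Y, dist (y + tinf) y' ≤ δ / 4) ∧ (∃ y' ∈ Y, dist (y - tinf) y' ≤ δ / 4) := by
    intro y hy
    have key : ∀ η : ℝ, 0 < η →
        (∃ y' ∈ Y, dist (y + tinf) y' ≤ δ / 4 + η) ∧ (∃ y' ∈ Y, dist (y - tinf) y' ≤ δ / 4 + η) := by
      intro η hη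
      have e1 := hmatch (‖y‖ + b + δ + η) (η / 4) (by positivity)
      have e3 : ∀ᶠ k in atTop, dist (t (φ₁ (φ₂ k))) tinf ≤ η / 4 :=
        (Metric.tendsto_nhds.1 hlimψ (η / 4) (by positivity)).mono fun k hk => hk.le
      have e4 := hrad (‖y‖ + η)
      obtain ⟨k, hk1, hk3, hk4⟩ := (e1.and (e3.and e4)).exists
      have hyn : ‖y‖ ≤ ‖y‖ + b + δ + η := by linarith [hδ.le]
      obtain ⟨p, hp, hpy⟩ := hk1.1 y hy hyn
      have hpn : ‖p‖ ≤ ‖y‖ + η / 4 := by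
        have h1 : ‖p‖ ≤ ‖y‖ + dist p y := by
          have := norm_le_norm_add_norm_sub' p y
          rwa [← dist_eq_norm] at this
        linarith
      have hpk : ‖p‖ ≤ ((φ₁ (φ₂ k) : ℕ) : ℝ) := by linarith
      obtain ⟨⟨q₁, hq₁, hq₁d⟩, ⟨q₂, hq₂, hq₂d⟩⟩ := hAP (φ₁ (φ₂ k)) p hp hpk
      have htk : ‖t (φ₁ (φ₂ k))‖ ≤ b := htb _
      have hq₁n : ‖q₁‖ ≤ ‖y‖ + b + δ + η := by
        have h1 : ‖q₁‖ ≤ ‖p + t (φ₁ (φ₂ k))‖ + dist q₁ (p + t (φ₁ (φ₂ k))) := by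
          have := norm_le_norm_add_norm_sub' q₁ (p + t (φ₁ (φ₂ k)))
          rwa [← dist_eq_norm] at this
        have h2 : ‖p + t (φ₁ (φ₂ k))‖ ≤ ‖p‖ + ‖t (φ₁ (φ₂ k))‖ := norm_add_le _ _
        rw [dist_comm] at h1
        linarith
      have hq₂n : ‖q₂‖ ≤ ‖y‖ + b + δ + η := by
        have h1 : ‖q₂‖ ≤ ‖p - t (φ₁ (φ₂ k))‖ + dist q₂ (p - t (φ₁ (φ₂ k))) := by
          have := norm_le_norm_add_norm_sub' q₂ (p - t (φ₁ (φ₂ k)))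
          rwa [← dist_eq_norm] at this
        have h2 : ‖p - t (φ₁ (φ₂ k))‖ ≤ ‖p‖ + ‖t (φ₁ (φ₂ k))‖ := norm_sub_le _ _
        rw [dist_comm] at h1
        linarith
      obtain ⟨y₁, hy₁, hqy₁⟩ := hk1.2 q₁ hq₁ hq₁n
      obtain ⟨y₂, hy₂, hqy₂⟩ := hk1.2 q₂ hq₂ hq₂n
      refine ⟨⟨y₁, hy₁, ?_⟩, ⟨y₂, hy₂, ?_⟩⟩
      · calc dist (y + tinf) y₁
            ≤ dist (y + tinf) (p + t (φ₁ (φ₂ k))) + dist (p + t (φ₁ (φ₂ k))) y₁ := dist_triangle _ _ _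
          _ ≤ (dist y p + dist tinf (t (φ₁ (φ₂ k)))) + (dist (p + t (φ₁ (φ₂ k))) q₁ + dist q₁ y₁) :=
              add_le_add (dist_add_add_le _ _ _ _) (dist_triangle _ _ _)
          _ ≤ (η / 4 + η / 4) + (δ / 4 + η / 4) := by
              gcongr
              · rwa [dist_comm] at hpy
              · rwa [dist_comm] at hk3
          _ ≤ δ / 4 + η := by linarith
      · calc dist (y - tinf) y₂
            ≤ dist (y - tinf) (p - t (φ₁ (φ₂ k))) + dist (p - t (φ₁ (φ₂ k))) y₂ := dist_triangle _ _ _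
          _ ≤ (dist y p + dist tinf (t (φ₁ (φ₂ k)))) + (dist (p - t (φ₁ (φ₂ k))) q₂ + dist q₂ y₂) :=
              add_le_add (dist_sub_sub_le _ _ _ _) (dist_triangle _ _ _)
          _ ≤ (η / 4 + η / 4) + (δ / 4 + η / 4) := by
              gcongr
              · rwa [dist_comm] at hpy
              · rwa [dist_comm] at hk3
          _ ≤ δ / 4 + η := by linarith
    exact ⟨hattain (y + tinf) fun η hη => (key η hη).1, hattain (y - tinf) fun η hη => (key η hη).2⟩
  -- (iv) Y is a hull point (the hull is closed under local limits)
  have hYhull : ∀ R ε : ℝ, 0 < ε → ∃ᶠ N in Filter.atTop, ∃ s : EuclideanSpace ℝ (Fin 3),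
      (∀ p ∈ Y, ‖p‖ ≤ R → ∃ i : Fin N, dist (x N i + s) p ≤ ε) ∧
      (∀ i : Fin N, ‖x N i + s‖ ≤ R → ∃ p ∈ Y, dist (x N i + s) p ≤ ε) := by
    intro R ε hε
    obtain ⟨k, hk⟩ := (hmatch (R + ε) (ε / 2) (by positivity)).exists
    refine (hhull (φ₁ (φ₂ k)) (R + ε) (ε / 2) (by positivity)).mono ?_
    rintro N ⟨s, hs1, hs2⟩
    refine ⟨s, fun p hp hpR => ?_, fun i hi => ?_⟩
    · obtain ⟨q, hq, hqp⟩ := hk.1 p hp (by linarith)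
      have hqR : ‖q‖ ≤ R + ε := by
        have h1 : ‖q‖ ≤ ‖p‖ + dist q p := by
          have := norm_le_norm_add_norm_sub' q p
          rwa [← dist_eq_norm] at this
        linarith
      obtain ⟨i, hi⟩ := hs1 q hq hqR
      exact ⟨i, (dist_triangle _ q _).trans (by linarith)⟩
    · obtain ⟨q, hq, hiq⟩ := hs2 i (by linarith)
      have hqR : ‖q‖ ≤ R + ε := by
        have h1 : ‖q‖ ≤ ‖x N i + s‖ + dist q (x N i + s) := by
          have := norm_le_norm_add_norm_sub' q (x N i + s)
          rwa [← dist_eq_norm] at this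
        rw [dist_comm] at h1
        linarith
      obtain ⟨p, hp, hqp⟩ := hk.2 q hq hqR
      exact ⟨p, hp, (dist_triangle _ q _).trans (by linarith)⟩
  -- (v) assemble
  exact ⟨Y, δ, hδ, hYsep, ⟨r + 1, hYden⟩, hYhull, tinf, hta_inf, hper⟩

/-- The converse direction of the EQUIV (global ⇒ scale-uniform) is trivial: `X_L := X`, `b := ‖t‖`. -/
theorem scaleUniform_of_global (x : (N : ℕ) → (Fin N → EuclideanSpace ℝ (Fin 3)))
    (h : ∃ X : Set (EuclideanSpace ℝ (Fin 3)), ∃ δ : ℝ, 0 < δ ∧ (∀ p ∈ X, ∀ q ∈ X, p ≠ q → δ ≤ dist p q) ∧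
      (∃ r : ℝ, ∀ c : EuclideanSpace ℝ (Fin 3), ∃ p ∈ X, dist p c ≤ r) ∧
      (∀ R ε : ℝ, 0 < ε → ∃ᶠ N in Filter.atTop, ∃ t : EuclideanSpace ℝ (Fin 3),
        (∀ p ∈ X, ‖p‖ ≤ R → ∃ i : Fin N, dist (x N i + t) p ≤ ε) ∧
        (∀ i : Fin N, ‖x N i + t‖ ≤ R → ∃ p ∈ X, dist (x N i + t) p ≤ ε)) ∧
      ∃ t : EuclideanSpace ℝ (Fin 3), δ ≤ ‖t‖ ∧ ∀ p ∈ X, (∃ q ∈ X, dist (p + t) q ≤ δ / 4) ∧ (∃ q ∈ X, dist (p - t) q ≤ δ / 4)) :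
    ∃ δ r b : ℝ, 0 < δ ∧ ∀ L : ℝ, ∃ X : Set (EuclideanSpace ℝ (Fin 3)),
      (∀ p ∈ X, ∀ q ∈ X, p ≠ q → δ ≤ dist p q) ∧ (∀ c : EuclideanSpace ℝ (Fin 3), ∃ p ∈ X, dist p c ≤ r) ∧
      (∀ R ε : ℝ, 0 < ε → ∃ᶠ N in Filter.atTop, ∃ t : EuclideanSpace ℝ (Fin 3),
        (∀ p ∈ X, ‖p‖ ≤ R → ∃ i : Fin N, dist (x N i + t) p ≤ ε) ∧
        (∀ i : Fin N, ‖x N i + t‖ ≤ R → ∃ p ∈ X, dist (x N i + t) p ≤ ε)) ∧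
      ∃ t : EuclideanSpace ℝ (Fin 3), δ ≤ ‖t‖ ∧ ‖t‖ ≤ b ∧
        ∀ p ∈ X, ‖p‖ ≤ L → (∃ q ∈ X, dist (p + t) q ≤ δ / 4) ∧ (∃ q ∈ X, dist (p - t) q ≤ δ / 4) := by
  obtain ⟨X, δ, hδ, hsep, ⟨r, hr⟩, hH, t, ht, hap⟩ := h
  exact ⟨δ, r, ‖t‖, hδ, fun L => ⟨X, hsep, hr, hH, t, ht, le_rfl, fun p hp _ => hap p hp⟩⟩

end PeriodCoherenceLadderGlobalFromScaleUniform

end Summit.AtomisticToContinuum.Crystallization.Theorems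

end
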